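import Literature.AnabelianGeometry.AbsoluteAnabelian.MonoidKummerMapsSub
import Literature.AnabelianGeometry.AbsoluteAnabelian.AutPairCenterFreeProofs

/-!
# [AbsTopIII] Proposition 3.2 (iv): id-rigidity of `𝒞^{MLF-H}_TM` from centre-freeness — PROOFS
# (sub-DAG rows P32.iv.L13a, P32.iv.L17 of plan/L4/SUBDAG-AbsTopIII-Prop32.md)

S. Mochizuki, *Topics in absolute anabelian geometry III*, §3, Proposition 3.2 (iv) p. 72 l.22–28 and its proof
p. 72 l.45–49 (bib key `MochizukiAbsTopIII2015`; locators = kurims manuscript pages, lit key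
`paper:url-5493eb38cbb7`): «In particular, if `(Π ↷ M_T)` is of hyperbolic orbicurve type, then the group
`Aut_{𝒞^MLF_T}((Π ↷ M_T))` — which is isomorphic to a subgroup of `Aut_{𝒯𝒢}(Π)` that contains the subgroup of
`Aut_{𝒯𝒢}(Π)` determined by the inner automorphisms of `Π` — is center-free; the categories … `𝒞^{MLF-hyp}_T`,
`𝒞^{MLF-sB}_T`, … are id-rigid [cf. §0]». abc-iut cell, seat abc-iut-w4-d045 (holder of SUBDAG
AbsTopIII:Prop3.2 (i)(iv), L4-lead 2026-08-26T00:14:10Z); companion of `MonoidKummerMapsSub.lean` (the row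
statements) over abc-iut-L4-t2's `MonoidKummerMaps.lean` / `MLFGaloisCategories.lean` and abc-iut-L6-t13's
`AutPairCenterFreeProofs.lean`. Contents:

* the small dictionary between the two notions of isomorphism of pairs that the typed files use side by side —
  L4-t2's structure `GaloisMonoidPair.Iso` (Def 3.1 (ii): homeomorphism + monoid isomorphism compatible with the
  actions) and isomorphisms in the CATEGORY of pairs (`MLFGaloisCategories`, Def 3.1 (iii)):
  `GaloisMonoidPair.isoOfCatIso`, `GaloisMonoidPair.Iso.toHom`, `.symm'`, `.toCatIso` (DEFINED, with their
  apply-lemmas) — needed because (iv)'s centre-freeness is typed on `GaloisMonoidPair.Iso` while id-rigidity is a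
  statement about the category;
* row P32.iv.L13a «contains the subgroup … determined by the inner automorphisms of `Π`»: `GaloisMonoidPair.Iso.conj`
  — conjugation by `g ∈ Π` together with `m ↦ g • m` IS an automorphism of the pair (CONSTRUCTED);
* row P32.iv.L17 DISCHARGED for `T = TM` modulo (iv)'s centre-freeness: `prop32iv_idRigid_TM_of_autPairCenterFree :
  AutPairCenterFree H → Prop32iv_idRigid .TM H` (the printed step «[cf. §0]»: a natural automorphism of the
  identity functor is objectwise central in `Aut`, hence trivial — `isIdRigid_of_aut_center_trivial` of the
  statements file), and hence modulo the slimness of `Π` («follows immediately from the slimness of `Π`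
  [cf. [Mzk20], Prop 2.3 (ii)]»): `prop32iv_idRigid_TM_of_isSlimGroup` via L6-t13's
  `autPairCenterFree_of_isSlimGroup`.

HONEST FRAMING: OUR kernel proofs of elementary deductions printed in a refereed 2015 paper, relative to the
named inputs (centre-freeness / slimness); nothing here bears on [IUTchIII] Cor. 3.12; typed ≠ proved for
the inputs themselves.
-/

namespace Literature.AnabelianGeometry.AbsoluteAnabelian

open _root_.CategoryTheory

universe u

noncomputable section

/-! ### Bridges: isomorphisms of pairs (Def 3.1 (ii)) ↔ isomorphisms in the category of pairs (Def 3.1 (iii)) -/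

namespace GaloisMonoidPair

variable {P Q : GaloisMonoidPair.{u}}

/-- An isomorphism in the category of pairs (Def 3.1 (iii)) yields an isomorphism of pairs in the sense of
Def 3.1 (ii) (`GaloisMonoidPair.Iso`: a homeomorphism of topological groups and a monoid isomorphism,
compatible with the actions). [cite: MochizukiAbsTopIII2015, Definition 3.1 (iii) p.67] -/
def isoOfCatIso (a : P ≅ Q) : GaloisMonoidPair.Iso P Q where
  isoPi :=
    { toFun := a.hom.homPi
      invFun := a.inv.homPi
      left_inv := fun g => by
        have h := congrArg (fun φ : P.Hom P => φ.homPi g) a.hom_inv_id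
        exact h
      right_inv := fun g => by
        have h := congrArg (fun φ : Q.Hom Q => φ.homPi g) a.inv_hom_id
        exact h
      map_mul' := fun g h => a.hom.homPi.map_mul g h
      continuous_toFun := a.hom.continuous_homPi
      continuous_invFun := a.inv.continuous_homPi }
  isoM :=
    { toFun := a.hom.homM
      invFun := a.inv.homM
      left_inv := fun x => by
        have h := congrArg (fun φ : P.Hom P => φ.homM x) a.hom_inv_id
        exact h
      right_inv := fun x => by
        have h := congrArg (fun φ : Q.Hom Q => φ.homM x) a.inv_hom_id
        exact h
      map_mul' := fun x y => a.hom.homM.map_mul x y }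
  smul_comm g x := a.hom.smul_comm g x

/-- The Galois component of `isoOfCatIso a` is `a.hom.homPi`. [cite: MochizukiAbsTopIII2015, Definition 3.1 (iii) p.67] -/
@[simp] theorem isoOfCatIso_isoPi_apply (a : P ≅ Q) (g : P.Pi) : (isoOfCatIso a).isoPi g = a.hom.homPi g := rfl
/-- The monoid component of `isoOfCatIso a` is `a.hom.homM`. [cite: MochizukiAbsTopIII2015, Definition 3.1 (iii) p.67] -/
@[simp] theorem isoOfCatIso_isoM_apply (a : P ≅ Q) (x : P.M) : (isoOfCatIso a).isoM x = a.hom.homM x := rfl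

/-- Conversely an isomorphism of pairs in the sense of Def 3.1 (ii) is a morphism of pairs (Def 3.1 (iii):
the induced map on arithmetic Galois groups is then an isomorphism, in particular open injective).
[cite: MochizukiAbsTopIII2015, Definition 3.1 (iii) p.67] -/
def Iso.toHom (e : GaloisMonoidPair.Iso P Q) : P.Hom Q where
  homPi := e.isoPi.toMonoidHom
  continuous_homPi := e.isoPi.continuous
  homM := e.isoM.toMonoidHom
  smul_comm g x := e.smul_comm g x
  comap_ker := by
    ext g
    simp only [Subgroup.mem_comap, actionKer, MonoidHom.mem_ker, MulEquiv.ext_iff, MulAut.one_apply,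
      MulDistribMulAction.toMulAut_apply, MulDistribMulAction.toMulEquiv_apply]
    constructor
    · intro h x
      have hx := h (e.isoM x)
      rw [show ((e.isoPi.toMonoidHom g) : Q.Pi) = e.isoPi g from rfl, ← e.smul_comm] at hx
      exact e.isoM.injective hx
    · intro h y
      obtain ⟨x, rfl⟩ := e.isoM.surjective y
      rw [show ((e.isoPi.toMonoidHom g) : Q.Pi) = e.isoPi g from rfl, ← e.smul_comm, h x]
  isOpen_image U hU := by
    refine Subgroup.isOpen_mono le_sup_left ?_
    rw [Subgroup.coe_map]
    exact e.isoPi.isOpenMap _ hU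

/-- The Galois component of `e.toHom` is `e.isoPi`. [cite: MochizukiAbsTopIII2015, Definition 3.1 (iii) p.67] -/
@[simp] theorem Iso.toHom_homPi_apply (e : GaloisMonoidPair.Iso P Q) (g : P.Pi) : e.toHom.homPi g = e.isoPi g := rfl
/-- The monoid component of `e.toHom` is `e.isoM`. [cite: MochizukiAbsTopIII2015, Definition 3.1 (iii) p.67] -/
@[simp] theorem Iso.toHom_homM_apply (e : GaloisMonoidPair.Iso P Q) (x : P.M) : e.toHom.homM x = e.isoM x := rfl

/-- The inverse isomorphism of pairs. [cite: MochizukiAbsTopIII2015, Definition 3.1 (ii) p.67] -/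
def Iso.symm' (e : GaloisMonoidPair.Iso P Q) : GaloisMonoidPair.Iso Q P where
  isoPi := e.isoPi.symm
  isoM := e.isoM.symm
  smul_comm g y := by
    apply e.isoM.injective
    obtain ⟨x, rfl⟩ := e.isoM.surjective y
    obtain ⟨h, rfl⟩ := e.isoPi.surjective g
    simp [e.smul_comm]

/-- The automorphism of the categorical object determined by a self-isomorphism of pairs.
[cite: MochizukiAbsTopIII2015, Definition 3.1 (iii) p.67] -/
def Iso.toCatIso (e : GaloisMonoidPair.Iso P Q) : P ≅ Q where
  hom := e.toHom
  inv := e.symm'.toHom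
  hom_inv_id := GaloisMonoidPair.Hom.ext (MonoidHom.ext fun g => e.isoPi.symm_apply_apply g)
    (MonoidHom.ext fun x => e.isoM.symm_apply_apply x)
  inv_hom_id := GaloisMonoidPair.Hom.ext (MonoidHom.ext fun g => e.isoPi.apply_symm_apply g)
    (MonoidHom.ext fun x => e.isoM.apply_symm_apply x)

/-- **Row P32.iv.L13a** (p. 72 l.23–25 «contains the subgroup of `Aut_{𝒯𝒢}(Π)` determined by the inner
automorphisms of `Π`»; proof l.45–47): conjugation by `g ∈ Π` on `Π` together with the action `m ↦ g • m` on
`M` is an isomorphism of the pair `(Π ↷ M)` with itself (CONSTRUCTED: compatibility is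
`g • (h • m) = (g h g⁻¹) • (g • m)`). [cite: MochizukiAbsTopIII2015, Proposition 3.2 (iv) p.72] -/
def Iso.conj (P : GaloisMonoidPair.{u}) (g : P.Pi) : GaloisMonoidPair.Iso P P where
  isoPi :=
    { MulAut.conj g with
      continuous_toFun := (continuous_const.mul continuous_id).mul continuous_const
      continuous_invFun := (continuous_const.mul continuous_id).mul continuous_const }
  isoM := MulDistribMulAction.toMulEquiv P.M g
  smul_comm h x := by
    show g • (h • x) = (g * h * g⁻¹) • g • x
    rw [mul_smul, mul_smul, inv_smul_smul]

/-- `Iso.conj P g` acts on `Π` by conjugation. [cite: MochizukiAbsTopIII2015, Proposition 3.2 (iv) p.72] -/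
@[simp] theorem Iso.conj_isoPi_apply (P : GaloisMonoidPair.{u}) (g h : P.Pi) :
    (Iso.conj P g).isoPi h = g * h * g⁻¹ := rfl

/-- `Iso.conj P g` acts on `M` by `g • ·`. [cite: MochizukiAbsTopIII2015, Proposition 3.2 (iv) p.72] -/
@[simp] theorem Iso.conj_isoM_apply (P : GaloisMonoidPair.{u}) (g : P.Pi) (x : P.M) :
    (Iso.conj P g).isoM x = g • x := rfl

end GaloisMonoidPair

/-- **Row P32.iv.L17 DISCHARGED for `T = TM` modulo the centre-freeness schema of (iv)**: if
`Aut_{𝒞^MLF_TM}((Π ↷ M))` is centre-free for every `TM`-pair satisfying `H` (L4-t2's `AutPairCenterFree H` —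
itself PROVED from the slimness of `Π` by `autPairCenterFree_of_isSlimGroup`), then the full subcategory
`𝒞^{MLF-H}_TM` is id-rigid («the categories … `𝒞^{MLF-hyp}_T`, `𝒞^{MLF-sB}_T` … are id-rigid», Prop 3.2 (iv)
p. 72 l.26–28). [cite: MochizukiAbsTopIII2015, Proposition 3.2 (iv) p.72] -/
theorem prop32iv_idRigid_TM_of_autPairCenterFree {H : GaloisMonoidPair.{0} → Prop}
    (hH : AutPairCenterFree H) : Prop32iv_idRigid.{0} .TM H := by
  refine isIdRigid_of_aut_center_trivial (MLFGaloisMonoidPairSubcat.{0} .TM H) fun X a ha => ?_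
  -- the underlying pair, its MLF-ness and the hypothesis `H`
  obtain ⟨⟨P, hP⟩, hX⟩ := X
  -- `a` as an isomorphism of pairs
  let aP : GaloisMonoidPair.Iso P P := GaloisMonoidPair.isoOfCatIso
    ((ObjectProperty.ι _).mapIso ((ObjectProperty.ι _).mapIso a))
  have hcomm : ∀ e' : GaloisMonoidPair.Iso P P,
      (∀ x, aP.isoM (e'.isoM x) = e'.isoM (aP.isoM x)) ∧ ∀ g, aP.isoPi (e'.isoPi g) = e'.isoPi (aP.isoPi g) := by
    intro e'
    -- lift `e'` to an automorphism `b` of the object `X` of the sub-subcategory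
    let b : (⟨⟨P, hP⟩, hX⟩ : MLFGaloisMonoidPairSubcat.{0} .TM H) ≅ ⟨⟨P, hP⟩, hX⟩ :=
      (ObjectProperty.fullyFaithfulι _).preimageIso ((ObjectProperty.fullyFaithfulι _).preimageIso e'.toCatIso)
    have hab : (a.hom ≫ b.hom).hom.hom = (b.hom ≫ a.hom).hom.hom :=
      congrArg (fun φ => φ.hom.hom) (congrArg Iso.hom (ha b))
    -- `(a ≪≫ b).hom = a.hom ≫ b.hom`, composed constituentwise as morphisms of pairs
    have hM : ∀ x, e'.isoM (aP.isoM x) = aP.isoM (e'.isoM x) := fun x =>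
      congrArg (fun φ : P.Hom P => φ.homM x) hab
    have hPi : ∀ g, e'.isoPi (aP.isoPi g) = aP.isoPi (e'.isoPi g) := fun g =>
      congrArg (fun φ : P.Hom P => φ.homPi g) hab
    exact ⟨fun x => (hM x).symm, fun g => (hPi g).symm⟩
  obtain ⟨hMid, hPiId⟩ := hH P hP hX aP (fun e' => (hcomm e').1) (fun e' => (hcomm e').2)
  refine Iso.ext (ObjectProperty.hom_ext _ (ObjectProperty.hom_ext _
    (GaloisMonoidPair.Hom.ext (MonoidHom.ext fun g => ?_) (MonoidHom.ext fun x => ?_))))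
  · exact hPiId g
  · exact hMid x

/-- **Row P32.iv.L17 for `T = TM`, modulo slimness** — the printed chain «centre-free … follows immediately from
the slimness of `Π` [cf. [Mzk20], Proposition 2.3, (ii)] … the categories … are id-rigid»: if `H` forces `Π` to be
slim (tree predicate `IsSlimGroup`), the full subcategory `𝒞^{MLF-H}_TM` is id-rigid (L6-t13's
`autPairCenterFree_of_isSlimGroup` composed with `prop32iv_idRigid_TM_of_autPairCenterFree`).
[cite: MochizukiAbsTopIII2015, Proposition 3.2 (iv) p.72] -/
theorem prop32iv_idRigid_TM_of_isSlimGroup {H : GaloisMonoidPair.{0} → Prop}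
    (hslim : ∀ P : GaloisMonoidPair.{0}, IsMLFGaloisMonoidPair .TM P → H P →
      Literature.AlgebraicGeometry.Frobenioids.IsSlimGroup P.Pi) :
    Prop32iv_idRigid.{0} .TM H :=
  prop32iv_idRigid_TM_of_autPairCenterFree (autPairCenterFree_of_isSlimGroup hslim)

end

end Literature.AnabelianGeometry.AbsoluteAnabelian
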